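import Summits.BirchSwinnertonDyer.BirchSwinnertonDyer.Theorems.ResidualThetaTransportAtTwoResidualSignedLambdaLowerCMAtTwoLayerPairingScalar
import Summits.BirchSwinnertonDyer.BirchSwinnertonDyer.Theorems.ResidualThetaTransportAtTwoResidualSignedLambdaLowerCMAtTwoAwayExhaustion
import HarnessLib

/-!
# `AwayPins.hlocdS_smul` is AUTOMATIC: an S₀-side localisation `locdS : 𝐇¹ →+ P_{S₀}` carrying the VALUE PIN `hlocdS` (with the binder `ℤ₂`-structures
# pinned to `DlocSMul`, `hD`) is `ℤ₂`-compatible — `locdS ((C ι a) • x) = a • locdS x`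

Route `ResidualThetaTransportAtTwo` (RTT), crux RSL_g `ResidualSignedLambdaLowerCMAtTwo` (stmt-BirchSwinnertonDyer-22608), line «onepair» (v3d), GLUE-SPEC-g18 T2(b) E3
(LEAD rtt-p2 g19 L2 `…AwayPinsExist`: «`hlocdS_smul` from `dlocModule_smul_def` + coefficient naturality»). Seat `prover-bsd-wall-tp2-p2x-w2` g20 (`--supports`,
closes nothing). THEOREMS ONLY. BSD is not proved by any of this; RSL_g (22608) stays OPEN.

* **`OnePairPins.locdS_smul_of_valuePin`** — for ANY additive `locdS : I.H →+ PAway S κ ρ S₀` satisfying the value pin `AwayPins.hlocdS` VERBATIM and binder structures with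
  `AwayPins.hD` VERBATIM: `locdS ((PowerSeries.C (ι a)) • x) = a • locdS x` (= `AwayPins.hlocdS_smul` VERBATIM). Proof: separation on the pinned images
  (`ProfiniteExhaustion.eq_of_jAway`, p700479), `CharacterModule.smul_apply`, `hD`, `DlocSMul_jAway` and the balance
  `layerPairingOf_reduce_conjMap_proj_C_smul` (`…LayerPairingScalar`, p707702). So E3 only has to produce `locdS` with `hlocdS` (and `hD := dlocModule_smul_def`).

References: [Kato2004Asterisque] §13.8 (pp. 228–229); [GreenbergVatsal2000] §2 Prop. 2.4; [SerreGaloisCohomology1997] I §2.2 Prop. 8.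
-/

set_option autoImplicit false
-- the Theorems namespace of this sub repeats the summit name by design (D-0017 nested layout)
set_option linter.dupNamespace false

noncomputable section

open scoped Classical

namespace Summit.BirchSwinnertonDyer.BirchSwinnertonDyer.Theorems.OnePair.OnePairPins

open CategoryTheory Field NumberField IsDedekindDomain
  Literature.NumberTheory.EllipticCurves Literature.NumberTheory.GaloisRepresentations
  Literature.NumberTheory.EllipticCurves.GreenbergSelmer Literature.NumberTheory.EllipticCurves.CyclotomicLayer
  Literature.NumberTheory.EllipticCurves.Kobayashi2003
  Summit.BirchSwinnertonDyer.BirchSwinnertonDyer.Theorems.ThetaTransport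

variable {S : Set (PadicAlgCl 2)} {W : WeierstrassCurve ℚ} [W.IsElliptic] {κ : ZpExtension ℚ 2} {γ : absoluteGaloisGroup ℚ}
  {S₀ : Finset (HeightOneSpectrum (𝓞 ℚ))} {n : ℕ} {ρ : FramedGaloisRep ℚ ↥(padicCoeffIntegers S) 2}
  {Θ : ∀ v : HeightOneSpectrum (𝓞 ℚ), ((2 : ℕ) : 𝓞 ℚ) ∈ v.asIdeal → (Cofree ρ ↥(padicCoeffField S) ≃+ (Fin n → ↥(W.geomPrimaryTorsion 2)))}
  {hΘ : ∀ v hv (δ : absoluteGaloisGroup (v.adicCompletion ℚ)) m i,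
    Θ v hv (resGalOfEmb (closureEmb (K := ℚ) (v.adicCompletion ℚ)) δ • m) i = resGalOfEmb (closureEmb (K := ℚ) (v.adicCompletion ℚ)) δ • Θ v hv m i}
  {I : Kato2004.IwasawaH1DataCoeff (FramedGaloisRep.toGaloisRep ρ) 2 κ γ}
  {Sg : AddSubgroup (subgroupH1 κ.kerSubgroup (Cofree ρ ↥(padicCoeffField S)))} [Module ↥(padicCoeffIntegers S) ↥Sg]
  (π : OnePairPins S W κ γ S₀ n ρ Θ hΘ I Sg) [∀ w : ↥S₀, Module ℤ_[2] (Dloc S κ ρ (w : HeightOneSpectrum (𝓞 ℚ)))]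

-- the coercion towers of the value pin exceed the default budget (as in `…CofreeSelmerTransferKummer`)
set_option maxHeartbeats 1600000 in
/-- **`AwayPins.hlocdS_smul` from `hlocdS` + `hD`.** Any additive `locdS : 𝐇¹ →+ P_{S₀}` with the value pin `hlocdS` (levelwise from the floor, on the images `jAway`),
under binder `ℤ₂`-structures equal to the functorial action (`hD`), satisfies `locdS ((C ι a) • x) = a • locdS x`. The two sides agree on every pinned image:
`(a • χ) y = χ (a • y)` (`CharacterModule.smul_apply`), `a • j y' = j ((a·)_* y')` (`hD`, `DlocSMul_jAway`), and `⟨red conj proj((C ι a) • x), y'⟩ = ⟨red conj proj x, (a·)_* y'⟩`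
(`layerPairingOf_reduce_conjMap_proj_C_smul`); then `eq_of_jAway`. [cite: Kato2004Asterisque, §13.8 (pp. 228–229)] [cite: GreenbergVatsal2000, §2 Prop. 2.4]
[cite: SerreGaloisCohomology1997, I §2.2 Prop. 8] -/
theorem locdS_smul_of_valuePin
    (hD : ∀ (w : ↥S₀) (a : ℤ_[2]) (y : Dloc S κ ρ (w : HeightOneSpectrum (𝓞 ℚ))), a • y = DlocSMul S κ ρ w (padicIntToCoeffIntegers S a) y)
    (locdS : I.H →+ PAway S κ ρ S₀)
    (hlocdS : ∀ (w : ↥S₀) (c : Cosets κ (w : HeightOneSpectrum (𝓞 ℚ))) (m : ℕ), nfl (w : HeightOneSpectrum (𝓞 ℚ)) ≤ m → ∀ (k : ℕ) (x : I.H)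
      (y : Dlev S κ ρ w m k),
      locdS x w c (jAway S κ ρ w m k y) =
        (layerPairingOf (cofreeTorsionGaloisModule S ρ ((2 ^ k : ℕ) : ℤ)) (2 ^ k) (π.ePk k) (π.hμPk k) (π.hadd₁Pk k) (π.hadd₂Pk k) (π.hgalPk k) κ w m
          (reduceH1CofreePkTorsion S ρ k (κ.layerSubgroup m)
            (conjMap (FramedGaloisRep.toGaloisRep ρ).toTopRep (κ.layerSubgroup m) c.out 1 (I.proj m x))) y).val •
          ((((2 : ℚ) ^ k)⁻¹ : ℚ) : AddCircle (1 : ℚ)))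
    (a : ℤ_[2]) (x : I.H) :
    locdS ((PowerSeries.C (padicIntToCoeffIntegers S a) : IwasawaAlgebraO S) • x) = a • locdS x := by
  funext w c
  refine DFunLike.ext _ _ fun y ↦ ?_
  refine ProfiniteExhaustion.eq_of_jAway S κ ρ (w : HeightOneSpectrum (𝓞 ℚ))
    (fun y ↦ locdS ((PowerSeries.C (padicIntToCoeffIntegers S a) : IwasawaAlgebraO S) • x) w c y) (fun y ↦ (a • locdS x) w c y) ?_ y
  intro m hm k y'
  rw [hlocdS w c m hm k _ y', Pi.smul_apply, Pi.smul_apply, CharacterModule.smul_apply, hD, DlocSMul_jAway, hlocdS w c m hm k x _,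
    layerPairingOf_reduce_conjMap_proj_C_smul]

end Summit.BirchSwinnertonDyer.BirchSwinnertonDyer.Theorems.OnePair.OnePairPins

end
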